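import Mathlib.Geometry.Manifold.MFDeriv.Atlas
import Literature.Topology.FourManifolds.BandSum
import Literature.Topology.FourManifolds.KnotFlatArc
import Literature.Topology.FourManifolds.PalaisBallComplement
import HarnessLib

/-!
# The unknot is a unit for the connected sum, I: the stereographic chart and a flat-arc frame

Topic `Literature/Topology/FourManifolds`; first file of the discharge of the named fact
`Literature.Topology.FourManifolds.Knot.exists_isConnectedSum_unknot_isIsotopic` (`BandSum.lean`;
Rolfsen, *Knots and Links* (1976), §2.G: `K # O ≅ K`). The whole construction is carried out in
the stereographic chart `ψ` of `𝕊³` from the south pole (`KnotsInBall.psi`), around a flat arc of a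
copy of the knot (`Knot.exists_flatArc_param`, `KnotFlatArc.lean`). This file records the
bookkeeping about `ψ` that the later files use, all proved:

* `BandSumUnit.frame i` (`i : Fin 3`) — the orthonormal frame of `ℝ³` which Mathlib's chart
  `stereographic'` (an *abstract* linear isometry of the tangent hyperplane at the pole onto `ℝ³`)
  assigns to the first three coordinate vectors of `ℝ⁴`; `coe_psi_symm_apply_castSucc`,
  `coe_psi_symm_apply_last` — the coordinates of `ψ⁻¹ z ∈ 𝕊³ ⊆ ℝ⁴` in terms of `⟪z, frame i⟫`
  and `‖z‖`; `psi_unknot` — the unknot `θ ↦ (cos θ, sin θ, 0, 0)` reads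
  `2 cos θ • frame 0 + 2 sin θ • frame 1` in the chart; the sign of the third coordinate of
  `ψ⁻¹ z` is the sign of `⟪z, frame 2⟫`.
* `injective_fderiv_coe_psi_symm` — the differential of `ℝ³ → 𝕊³ ⊆ ℝ⁴`, `z ↦ ψ⁻¹ z`, is
  injective (chart inverse, then the inclusion of the sphere).
* `BandSumUnit.FlatArcConfig` — the data delivered by `Knot.exists_flatArc_param` (a knot `K` off
  the south pole whose chart image contains the segment `p + s e`, `|s| ≤ ℓ`, traversed by
  `θ ↦ p + σ θ • e` over `[α, β]`, the whole knot at height `≥ p₂`, a clean box of height `ν`),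
  bundled as a structure, with `FlatArcConfig.nonempty K : ∃ C, K.IsIsotopic C.K`; the plane map
  `planeMap (s, d) = p + s e − d e₂` of the vertical plane through the segment (`d` = depth below
  the segment) and its lift `toSphere = ψ⁻¹ ∘ planeMap`, injective with injective differential;
  the scale `lam = min ℓ ν / 2` of the construction; the segment as the image of `[α, β]`.

## References

* D. Rolfsen, *Knots and Links* (1976), §2.G. [Rolfsen1976]
* M. W. Hirsch, *Differential Topology* (1976), Ch. 8 §1, Thm. 1.3 (the flat arc). [HirschDT1976]

## Design notes

Everything is `[folklore]`; no named facts, no `sorry`. `𝔼 n`, `𝕊 n` are local notation as in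
`Knots.lean`; the local instance `fact_finrank_euclideanSpace_succ` supplies Mathlib's sphere API.
-/

open scoped Manifold ContDiff Topology RealInnerProductSpace
open Function Set Metric Module

noncomputable section

namespace Literature.Topology.FourManifolds

/-- Local notation: `𝔼 n` is the model Euclidean space `EuclideanSpace ℝ (Fin n)`. -/
local notation "𝔼 " n:arg => EuclideanSpace ℝ (Fin n)

/-- Local notation: `𝕊 n` is the unit sphere in `EuclideanSpace ℝ (Fin (n + 1))`. -/
local notation "𝕊 " n:arg => (Metric.sphere (0 : EuclideanSpace ℝ (Fin (n + 1))) 1)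

attribute [local instance] fact_finrank_euclideanSpace_succ

namespace BandSumUnit

open KnotsInBall

/-! ### The frame of the stereographic chart -/

/-- The first three coordinate vectors of `ℝ⁴` are orthogonal to the south pole. [folklore] -/
theorem single_castSucc_mem_orthogonal (i : Fin 3) :
    (EuclideanSpace.single (Fin.castSucc i) (1 : ℝ) : 𝔼 4) ∈
      (ℝ ∙ ((southPole : 𝕊 3) : 𝔼 4))ᗮ := by
  rw [Submodule.mem_orthogonal_singleton_iff_inner_right, coe_southPole, inner_neg_left,
    EuclideanSpace.inner_single_left]
  fin_cases i <;> simp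

/-- The abstract linear isometry `vᗮ ≃ ℝ³` used by Mathlib's chart `stereographic' 3 v` at the
south pole `v`. [folklore] -/
def chartIso : (ℝ ∙ ((southPole : 𝕊 3) : 𝔼 4))ᗮ ≃ₗᵢ[ℝ] 𝔼 3 :=
  (OrthonormalBasis.fromOrthogonalSpanSingleton 3
    (ne_zero_of_mem_unit_sphere (southPole : 𝕊 3))).repr

/-- **The frame of the chart**: the images in `ℝ³` of the coordinate vectors `e₀, e₁, e₂` of
`ℝ⁴` under the chart isometry. [folklore] -/
def frame (i : Fin 3) : 𝔼 3 :=
  chartIso ⟨EuclideanSpace.single (Fin.castSucc i) 1, single_castSucc_mem_orthogonal i⟩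

/-- The tangential part of the chart inverse is the inverse chart isometry (definitional).
[folklore] -/
theorem stereoTangential_eq (z : 𝔼 3) :
    stereoTangential (southPole : 𝕊 3) z =
      ((chartIso.symm z : (ℝ ∙ ((southPole : 𝕊 3) : 𝔼 4))ᗮ) : 𝔼 4) := rfl

/-- The frame is orthonormal. [folklore] -/
theorem orthonormal_frame : Orthonormal ℝ frame := by
  rw [orthonormal_iff_ite]
  intro i j
  rw [frame, frame, LinearIsometryEquiv.inner_map_map, Submodule.coe_inner,
    EuclideanSpace.inner_single_left, PiLp.single_apply]
  by_cases h : i = j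
  · subst h; simp
  · simp [h]

/-- Inner products of frame vectors. [folklore] -/
@[simp] theorem inner_frame_frame (i j : Fin 3) :
    ⟪frame i, frame j⟫ = if i = j then (1 : ℝ) else 0 :=
  orthonormal_iff_ite.1 orthonormal_frame i j

/-- Frame vectors are unit vectors. [folklore] -/
@[simp] theorem norm_frame (i : Fin 3) : ‖frame i‖ = 1 := orthonormal_frame.1 i

/-- The frame is an orthonormal basis of `ℝ³` (three orthonormal vectors). [folklore] -/
def frameBasis : OrthonormalBasis (Fin 3) ℝ (𝔼 3) :=
  OrthonormalBasis.mk orthonormal_frame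
    (orthonormal_frame.linearIndependent.span_eq_top_of_card_eq_finrank (by simp)).ge

/-- The orthonormal basis is the frame. [folklore] -/
@[simp] theorem coe_frameBasis : ⇑frameBasis = frame :=
  OrthonormalBasis.coe_mk _ _

/-- Expansion of a vector of `ℝ³` in the frame. [folklore] -/
theorem sum_inner_frame_smul (z : 𝔼 3) : ∑ i, ⟪z, frame i⟫ • frame i = z := by
  conv_rhs => rw [← frameBasis.sum_repr z]
  refine Finset.sum_congr rfl fun i _ ↦ ?_
  rw [frameBasis.repr_apply_apply, coe_frameBasis, real_inner_comm]

/-- The tangential part `w(z) ∈ vᗮ ⊆ ℝ⁴` of the chart inverse (`stereoTangential`) has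
coordinates `⟪z, frame i⟫`. [folklore] -/
theorem stereoTangential_apply_castSucc (z : 𝔼 3) (i : Fin 3) :
    stereoTangential (southPole : 𝕊 3) z (Fin.castSucc i) = ⟪z, frame i⟫ := by
  have h1 : stereoTangential (southPole : 𝕊 3) z (Fin.castSucc i) =
      ⟪(EuclideanSpace.single (Fin.castSucc i) (1 : ℝ) : 𝔼 4),
        stereoTangential (southPole : 𝕊 3) z⟫ := by
    rw [EuclideanSpace.inner_single_left]; simp
  rw [h1, stereoTangential_eq]
  change ⟪((⟨EuclideanSpace.single (Fin.castSucc i) 1, single_castSucc_mem_orthogonal i⟩ :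
      (ℝ ∙ ((southPole : 𝕊 3) : 𝔼 4))ᗮ) : 𝔼 4),
    ((chartIso.symm z : (ℝ ∙ ((southPole : 𝕊 3) : 𝔼 4))ᗮ) : 𝔼 4)⟫ = _
  rw [← Submodule.coe_inner, ← chartIso.inner_map_map, chartIso.apply_symm_apply]
  exact real_inner_comm _ _

/-- The tangential part has vanishing last coordinate. [folklore] -/
theorem stereoTangential_apply_last (z : 𝔼 3) :
    stereoTangential (southPole : 𝕊 3) z (Fin.last 3) = 0 := by
  have h := inner_stereoTangential (southPole : 𝕊 3) z
  rw [coe_southPole, inner_neg_right, EuclideanSpace.inner_single_right] at h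
  simpa using h

/-- The tangential part of a frame vector is the corresponding coordinate vector. [folklore] -/
theorem stereoTangential_frame (i : Fin 3) :
    stereoTangential (southPole : 𝕊 3) (frame i) = EuclideanSpace.single (Fin.castSucc i) 1 := by
  rw [stereoTangential_eq, frame, chartIso.symm_apply_apply]

/-- `ψ⁻¹ z` in `ℝ⁴`: Mathlib's normalisation of the inverse stereographic projection.
[folklore] -/
theorem coe_psi_symm_eq (z : 𝔼 3) :
    ((psi.symm z : 𝕊 3) : 𝔼 4) = ((‖z‖ ^ 2 + 4)⁻¹ * 4) • stereoTangential (southPole : 𝕊 3) z +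
      ((‖z‖ ^ 2 + 4)⁻¹ * (‖z‖ ^ 2 - 4)) • ((southPole : 𝕊 3) : 𝔼 4) :=
  coe_stereographic'_symm_apply southPole z

/-- **Coordinates of `ψ⁻¹ z`**: the first three are `4 ⟪z, frame i⟫ / (‖z‖² + 4)`. [folklore] -/
theorem coe_psi_symm_apply_castSucc (z : 𝔼 3) (i : Fin 3) :
    ((psi.symm z : 𝕊 3) : 𝔼 4) (Fin.castSucc i) = (‖z‖ ^ 2 + 4)⁻¹ * 4 * ⟪z, frame i⟫ := by
  have h3 : (Fin.castSucc i : Fin 4) ≠ Fin.last 3 := (Fin.castSucc_lt_last i).ne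
  rw [coe_psi_symm_eq, PiLp.add_apply, PiLp.smul_apply, PiLp.smul_apply,
    stereoTangential_apply_castSucc, coe_southPole, PiLp.neg_apply, PiLp.single_apply, if_neg h3]
  simp

/-- **Coordinates of `ψ⁻¹ z`**: the last is `(‖z‖² - 4)/(‖z‖² + 4)`. [folklore] -/
theorem coe_psi_symm_apply_last (z : 𝔼 3) :
    ((psi.symm z : 𝕊 3) : 𝔼 4) (Fin.last 3) = -((‖z‖ ^ 2 + 4)⁻¹ * (‖z‖ ^ 2 - 4)) := by
  rw [coe_psi_symm_eq, PiLp.add_apply, PiLp.smul_apply, PiLp.smul_apply,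
    stereoTangential_apply_last, coe_southPole, PiLp.neg_apply, PiLp.single_apply, if_pos rfl]
  simp

/-- `‖z‖² + 4 > 0`. [folklore] -/
theorem normSq_add_four_pos (z : 𝔼 3) : 0 < ‖z‖ ^ 2 + 4 := by positivity

/-- **The sign of the third coordinate of `ψ⁻¹ z` is the sign of `⟪z, frame 2⟫`.** [folklore] -/
theorem coe_psi_symm_apply_two (z : 𝔼 3) :
    ((psi.symm z : 𝕊 3) : 𝔼 4) 2 = (‖z‖ ^ 2 + 4)⁻¹ * 4 * ⟪z, frame 2⟫ :=
  coe_psi_symm_apply_castSucc z 2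

/-- `(ψ⁻¹ z)₂ = 0 ↔ ⟪z, frame 2⟫ = 0`. [folklore] -/
theorem coe_psi_symm_apply_two_eq_zero_iff (z : 𝔼 3) :
    ((psi.symm z : 𝕊 3) : 𝔼 4) 2 = 0 ↔ ⟪z, frame 2⟫ = 0 := by
  rw [coe_psi_symm_apply_two]
  have h : (‖z‖ ^ 2 + 4)⁻¹ * 4 ≠ 0 := by
    have := normSq_add_four_pos z; positivity
  simp [h]

/-- `0 < (ψ⁻¹ z)₂ ↔ 0 < ⟪z, frame 2⟫`. [folklore] -/
theorem coe_psi_symm_apply_two_pos_iff (z : 𝔼 3) :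
    0 < ((psi.symm z : 𝕊 3) : 𝔼 4) 2 ↔ 0 < ⟪z, frame 2⟫ := by
  rw [coe_psi_symm_apply_two]
  have h : 0 < (‖z‖ ^ 2 + 4)⁻¹ * 4 := by
    have := normSq_add_four_pos z; positivity
  exact mul_pos_iff_of_pos_left h

/-- `(ψ⁻¹ z)₂ < 0 ↔ ⟪z, frame 2⟫ < 0`. [folklore] -/
theorem coe_psi_symm_apply_two_neg_iff (z : 𝔼 3) :
    ((psi.symm z : 𝕊 3) : 𝔼 4) 2 < 0 ↔ ⟪z, frame 2⟫ < 0 := by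
  rw [coe_psi_symm_apply_two]
  have h : 0 < (‖z‖ ^ 2 + 4)⁻¹ * 4 := by
    have := normSq_add_four_pos z; positivity
  constructor
  · intro h'
    by_contra hle
    push Not at hle
    have := mul_nonneg h.le hle
    linarith
  · intro h'
    exact mul_neg_of_pos_of_neg h h'

/-- **The unknot in the chart**: `ψ⁻¹ (2 cos θ • frame 0 + 2 sin θ • frame 1)` is the point
`(cos θ, sin θ, 0, 0)` of the standard great circle. [folklore] -/
theorem coe_psi_symm_two_cos_sin (θ : ℝ) :
    ((psi.symm ((2 * Real.cos θ) • frame 0 + (2 * Real.sin θ) • frame 1) : 𝕊 3) : 𝔼 4) =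
      euclideanInclusion 2 4 (circlePoint θ) := by
  set z : 𝔼 3 := (2 * Real.cos θ) • frame 0 + (2 * Real.sin θ) • frame 1 with hz
  have hnorm : ‖z‖ ^ 2 = 4 := by
    rw [← real_inner_self_eq_norm_sq, hz]
    simp only [inner_add_left, inner_add_right, inner_smul_left, inner_smul_right,
      inner_frame_frame]
    simp only [Fin.isValue, ↓reduceIte, one_ne_zero, zero_ne_one, conj_trivial]
    nlinarith [Real.sin_sq_add_cos_sq θ]
  have htan : stereoTangential (southPole : 𝕊 3) z =
      (2 * Real.cos θ) • EuclideanSpace.single (0 : Fin 4) 1 +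
        (2 * Real.sin θ) • EuclideanSpace.single (1 : Fin 4) 1 := by
    have hlin : ∀ (a b : ℝ) (x y : 𝔼 3), stereoTangential (southPole : 𝕊 3) (a • x + b • y) =
        a • stereoTangential (southPole : 𝕊 3) x + b • stereoTangential (southPole : 𝕊 3) y := by
      intro a b x y
      rw [stereoTangential_eq, stereoTangential_eq, stereoTangential_eq, map_add, map_smul,
        map_smul, Submodule.coe_add, Submodule.coe_smul, Submodule.coe_smul]
    rw [hz, hlin, stereoTangential_frame, stereoTangential_frame]
    rfl
  rw [coe_psi_symm_eq, hnorm, htan]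
  ext i
  fin_cases i <;> simp [euclideanInclusion_apply] <;> ring

/-- The unknot point `(cos θ, sin θ, 0, 0)` is `ψ⁻¹ (2 cos θ • frame 0 + 2 sin θ • frame 1)`.
[folklore] -/
theorem psi_symm_two_cos_sin [SphereEmbedding.SmoothnessFacts] (θ : ℝ) :
    psi.symm ((2 * Real.cos θ) • frame 0 + (2 * Real.sin θ) • frame 1) = unknot (circlePoint θ) :=
  Subtype.ext (coe_psi_symm_two_cos_sin θ)

/-- The unknot misses the south pole. [folklore] -/
theorem unknot_ne_southPole [SphereEmbedding.SmoothnessFacts] (x : 𝕊 1) :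
    unknot x ≠ southPole := by
  intro h
  have h' := congrArg (fun y : 𝕊 3 ↦ (y : 𝔼 4) (Fin.last 3)) h
  simp only [southPole_apply_last] at h'
  change (euclideanInclusion 2 4 x) (Fin.last 3) = -1 at h'
  rw [euclideanInclusion_apply] at h'
  simp at h'

/-- **The unknot in the chart**: `ψ (unknot (cos θ, sin θ)) = 2 cos θ • frame 0 + 2 sin θ • frame 1`,
a round circle of radius `2` in the plane of `frame 0`, `frame 1`. [folklore] -/
theorem psi_unknot [SphereEmbedding.SmoothnessFacts] (θ : ℝ) :
    psi (unknot (circlePoint θ)) = (2 * Real.cos θ) • frame 0 + (2 * Real.sin θ) • frame 1 := by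
  rw [← psi_symm_two_cos_sin, psi_apply_psi_symm]

/-! ### The differential of the chart inverse is injective -/

/-- The map `ℝ³ → ℝ⁴`, `z ↦ ψ⁻¹ z`. [folklore] -/
def coePsiSymm (z : 𝔼 3) : 𝔼 4 := ((psi.symm z : 𝕊 3) : 𝔼 4)

/-- Pointwise formula. [folklore] -/
@[simp] theorem coePsiSymm_apply (z : 𝔼 3) : coePsiSymm z = ((psi.symm z : 𝕊 3) : 𝔼 4) := rfl

/-- `z ↦ ψ⁻¹ z ∈ ℝ⁴` is `C^∞`. [folklore] -/
theorem contDiff_coePsiSymm : ContDiff ℝ ∞ coePsiSymm := Knot.contDiff_coe_psi_symm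

/-- `coePsiSymm` has unit norm. [folklore] -/
@[simp] theorem norm_coePsiSymm (z : 𝔼 3) : ‖coePsiSymm z‖ = 1 := norm_eq_of_mem_sphere _

/-- `coePsiSymm` is injective. [folklore] -/
theorem coePsiSymm_injective : Injective coePsiSymm := by
  intro z z' h
  have h1 : psi.symm z = psi.symm z' := Subtype.ext h
  have := congrArg psi h1
  rwa [psi_apply_psi_symm, psi_apply_psi_symm] at this

/-- **The differential of `z ↦ ψ⁻¹ z ∈ ℝ⁴` is injective** at every point: `ψ⁻¹` is the inverse of
a chart of the atlas (invertible differential) and the inclusion `𝕊³ ⊆ ℝ⁴` is an immersion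
(`mfderiv_coe_sphere_injective`). [folklore] -/
theorem injective_fderiv_coePsiSymm (z : 𝔼 3) : Injective (fderiv ℝ coePsiSymm z) := by
  have hn : (∞ : WithTop ℕ∞) ≠ 0 := by simp
  have h1 : MDifferentiableAt (𝓡 3) (𝓡 3) psi.symm z := contMDiff_psi_symm.mdifferentiableAt hn
  have h2 : MDifferentiableAt (𝓡 3) 𝓘(ℝ, 𝔼 4) (Subtype.val : (𝕊 3) → 𝔼 4) (psi.symm z) :=
    contMDiff_coe_sphere.mdifferentiableAt hn
  have hcomp : mfderiv 𝓘(ℝ, 𝔼 3) 𝓘(ℝ, 𝔼 4) coePsiSymm z =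
      (mfderiv (𝓡 3) 𝓘(ℝ, 𝔼 4) (Subtype.val : (𝕊 3) → 𝔼 4) (psi.symm z)).comp
        (mfderiv (𝓡 3) (𝓡 3) psi.symm z) := mfderiv_comp z h2 h1
  have hinj₁ : Injective (mfderiv (𝓡 3) (𝓡 3) psi.symm z) :=
    (mdifferentiable_of_mem_atlas (I := 𝓡 3) (⟨southPole, rfl⟩ :
      psi ∈ atlas (𝔼 3) (𝕊 3))).symm.mfderiv_injective
      (by rw [OpenPartialHomeomorph.symm_source, psi_target]; trivial)
  have hinj₂ := mfderiv_coe_sphere_injective (n := 3) (psi.symm z)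
  rw [← mfderiv_eq_fderiv, hcomp]
  exact hinj₂.comp hinj₁

/-- Chain rule through `ψ⁻¹`: for a curve `c : ℝ → ℝ³`,
`(ψ⁻¹ ∘ c)' = Dψ⁻¹(c θ) (c' θ)`. [folklore] -/
theorem deriv_coePsiSymm_comp {c : ℝ → 𝔼 3} {θ : ℝ} (hc : DifferentiableAt ℝ c θ) :
    deriv (fun t ↦ coePsiSymm (c t)) θ = fderiv ℝ coePsiSymm (c θ) (deriv c θ) :=
  fderiv_comp_deriv θ (contDiff_coePsiSymm.differentiable (by simp) _) hc

/-- The velocity of `ψ⁻¹ ∘ c` vanishes only where the velocity of `c` does. [folklore] -/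
theorem deriv_coePsiSymm_comp_ne_zero {c : ℝ → 𝔼 3} {θ : ℝ} (hc : DifferentiableAt ℝ c θ)
    (h : deriv c θ ≠ 0) : deriv (fun t ↦ coePsiSymm (c t)) θ ≠ 0 := by
  rw [deriv_coePsiSymm_comp hc]
  intro h0
  exact h ((injective_fderiv_coePsiSymm (c θ)) (by rw [h0, map_zero]))

/-! ### The vertical plane through a segment -/

/-- The upward vertical unit vector `e₂` of `ℝ³`. [folklore] -/
def vert : 𝔼 3 := EuclideanSpace.single 2 1

/-- Coordinates of `vert`. [folklore] -/
@[simp] theorem vert_apply (i : Fin 3) : vert i = if i = 2 then 1 else 0 := by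
  rw [vert, PiLp.single_apply]

/-- `vert` is a unit vector. [folklore] -/
@[simp] theorem norm_vert : ‖vert‖ = 1 := by simp [vert]

/-- `⟪z, vert⟫ = z₂`. [folklore] -/
@[simp] theorem inner_vert_right (z : 𝔼 3) : ⟪z, vert⟫ = z 2 := by
  rw [vert, EuclideanSpace.inner_single_right]; simp

/-- `⟪vert, z⟫ = z₂`. [folklore] -/
@[simp] theorem inner_vert_left (z : 𝔼 3) : ⟪vert, z⟫ = z 2 := by
  rw [real_inner_comm, inner_vert_right]

/-! ### Flat-arc configurations -/

/-- **A flat-arc configuration**: a knot `K` off the south pole together with the data of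
`Knot.exists_flatArc_param` — a base point `p`, a horizontal unit vector `e`, a half-length `ℓ`,
a box height `ν`, and a parametrisation `σ` of the straight segment `p + s e` (`|s| ≤ ℓ`) of the
chart image of `K` over the parameter interval `[α, β]` (of length `< 2π`); the whole knot lies at
height `≥ p₂`, and the only knot points with tangent coordinate `< ℓ` in absolute value and height
`< p₂ + ν` are the segment points. [folklore] -/
structure FlatArcConfig where
  /-- The knot. -/
  K : Knot
  /-- The knot misses the south pole (so it lies in the chart). -/
  ne_southPole : ∀ x, K x ≠ southPole
  /-- The base point of the segment (its midpoint region). -/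
  p : 𝔼 3
  /-- The direction of the segment. -/
  e : 𝔼 3
  /-- Half-length of the segment. -/
  ℓ : ℝ
  /-- Height of the clean box. -/
  ν : ℝ
  norm_e : ‖e‖ = 1
  e_two : e 2 = 0
  ℓ_pos : 0 < ℓ
  ν_pos : 0 < ν
  /-- The knot lies at height `≥ p₂`. -/
  height : ∀ x, p 2 ≤ psi (K x) 2
  /-- The box `{|⟪z - p, e⟫| < ℓ, z₂ < p₂ + ν}` meets the knot only along the segment. -/
  box : ∀ x, |⟪psi (K x) - p, e⟫| < ℓ → psi (K x) 2 < p 2 + ν →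
    ∃ s ∈ Icc (-ℓ) ℓ, psi (K x) = p + s • e
  /-- Start of the parameter window of the segment. -/
  α : ℝ
  /-- End of the parameter window of the segment. -/
  β : ℝ
  /-- The tangent coordinate along the window. -/
  σ : ℝ → ℝ
  α_lt_β : α < β
  β_lt : β < α + 2 * Real.pi
  contDiff_σ : ContDiff ℝ ∞ σ
  deriv_σ_pos : ∀ θ ∈ Icc α β, 0 < deriv σ θ
  σ_α : σ α = -ℓ
  σ_β : σ β = ℓ
  /-- Over the window the knot runs along the segment: `ψ (K (cos θ, sin θ)) = p + σ θ • e`. -/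
  seg : ∀ θ ∈ Icc α β, psi (K (circlePoint θ)) = p + σ θ • e

/-- **Every knot is isotopic to the knot of a flat-arc configuration**
(`Knot.exists_flatArc_param`). [cite: HirschDT1976, Ch. 8 §1, Thm. 1.3] -/
theorem FlatArcConfig.exists (K : Knot) : ∃ C : FlatArcConfig, K.IsIsotopic C.K := by
  obtain ⟨K', hKK', hS, p, e, ℓ, ν, he, he2, hℓ, hν, hheight, hbox, α, θ₁, β, σ, hαθ, hθβ, hβα,
    hσ, hσ', -, hσα, hσβ, hseg⟩ := K.exists_flatArc_param
  exact ⟨⟨K', hS, p, e, ℓ, ν, he, he2, hℓ, hν, hheight, hbox, α, β, σ, hαθ.trans hθβ, hβα, hσ,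
    hσ', hσα, hσβ, hseg⟩, hKK'⟩

namespace FlatArcConfig

variable (C : FlatArcConfig)

/-! #### The direction vector -/

/-- `⟪e, e⟫ = 1`. [folklore] -/
@[simp] theorem inner_e_e : ⟪C.e, C.e⟫ = 1 := by
  rw [real_inner_self_eq_norm_sq, C.norm_e]; norm_num

/-- `e` is horizontal: `⟪e, vert⟫ = 0`. [folklore] -/
@[simp] theorem inner_e_vert : ⟪C.e, vert⟫ = 0 := by rw [inner_vert_right, C.e_two]

/-- `⟪vert, e⟫ = 0`. [folklore] -/
@[simp] theorem inner_vert_e : ⟪vert, C.e⟫ = 0 := by rw [real_inner_comm, inner_e_vert]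

/-- `e ≠ 0`. [folklore] -/
theorem e_ne_zero : C.e ≠ 0 := by
  intro h; have := C.norm_e; rw [h, norm_zero] at this; norm_num at this

/-! #### The scale -/

/-- **The scale** `λ = min(ℓ, ν)/2` of the construction: the band has length `λ`, the small unknot
radius `λ`. [folklore] -/
def lam : ℝ := min C.ℓ C.ν / 2

/-- `0 < λ`. [folklore] -/
theorem lam_pos : 0 < C.lam := by
  have := C.ℓ_pos; have := C.ν_pos; unfold lam; positivity

/-- `λ ≤ ℓ/2`. [folklore] -/
theorem lam_le_half_ℓ : C.lam ≤ C.ℓ / 2 := by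
  unfold lam; have := min_le_left C.ℓ C.ν; linarith

/-- `λ ≤ ν/2`. [folklore] -/
theorem lam_le_half_ν : C.lam ≤ C.ν / 2 := by
  unfold lam; have := min_le_right C.ℓ C.ν; linarith

/-- `λ < ℓ`. [folklore] -/
theorem lam_lt_ℓ : C.lam < C.ℓ := by linarith [C.lam_le_half_ℓ, C.ℓ_pos]

/-- `λ < ν`. [folklore] -/
theorem lam_lt_ν : C.lam < C.ν := by linarith [C.lam_le_half_ν, C.ν_pos]

/-! #### The vertical plane through the segment -/

/-- **The plane map**: `(s, d) ↦ p + s e − d e₂`, the point of the vertical plane through the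
segment with tangent coordinate `s` at depth `d` below the segment. [folklore] -/
def planeMap (q : 𝔼 2) : 𝔼 3 := C.p + q 0 • C.e - q 1 • vert

/-- Pointwise formula. [folklore] -/
theorem planeMap_apply (q : 𝔼 2) : C.planeMap q = C.p + q 0 • C.e - q 1 • vert := rfl

/-- The plane map on `pt2`. [folklore] -/
theorem planeMap_pt2 (s d : ℝ) : C.planeMap (pt2 s d) = C.p + s • C.e - d • vert := rfl

/-- The linear part of the plane map. [folklore] -/
def planeLin : 𝔼 2 →L[ℝ] 𝔼 3 :=
  (EuclideanSpace.proj (0 : Fin 2)).smulRight C.e - (EuclideanSpace.proj (1 : Fin 2)).smulRight vert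

/-- The linear part applied. [folklore] -/
@[simp] theorem planeLin_apply (q : 𝔼 2) : C.planeLin q = q 0 • C.e - q 1 • vert := rfl

/-- The plane map is its base point plus its linear part. [folklore] -/
theorem planeMap_eq (q : 𝔼 2) : C.planeMap q = C.p + C.planeLin q := by
  rw [planeMap_apply, planeLin_apply, add_sub_assoc]

/-- Tangent coordinate of a plane point: `⟪planeMap (s, d) - p, e⟫ = s`. [folklore] -/
@[simp] theorem inner_planeMap_sub_e (q : 𝔼 2) : ⟪C.planeMap q - C.p, C.e⟫ = q 0 := by
  rw [planeMap_apply, add_sub_assoc, add_sub_cancel_left, inner_sub_left, inner_smul_left,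
    inner_smul_left, inner_e_e, inner_vert_e]
  simp

/-- Height of a plane point: `(planeMap (s, d))₂ = p₂ - d`. [folklore] -/
@[simp] theorem planeMap_apply_two (q : 𝔼 2) : C.planeMap q 2 = C.p 2 - q 1 := by
  rw [planeMap_apply, PiLp.sub_apply, PiLp.add_apply, PiLp.smul_apply, PiLp.smul_apply, C.e_two,
    vert_apply]
  simp

/-- `⟪planeLin q, e⟫ = q 0`. [folklore] -/
@[simp] theorem inner_planeLin_e (q : 𝔼 2) : ⟪C.planeLin q, C.e⟫ = q 0 := by
  rw [planeLin_apply, inner_sub_left, inner_smul_left, inner_smul_left, inner_e_e, inner_vert_e]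
  simp

/-- `⟪planeLin q, vert⟫ = -q 1`. [folklore] -/
@[simp] theorem inner_planeLin_vert (q : 𝔼 2) : ⟪C.planeLin q, vert⟫ = -q 1 := by
  rw [planeLin_apply, inner_sub_left, inner_smul_left, inner_smul_left, inner_e_vert,
    real_inner_self_eq_norm_sq, norm_vert]
  simp

/-- The linear part is injective. [folklore] -/
theorem planeLin_injective : Injective C.planeLin := by
  intro q q' h
  have h0 : q 0 = q' 0 := by rw [← C.inner_planeLin_e q, h, C.inner_planeLin_e]
  have h1 : q 1 = q' 1 := by
    have := C.inner_planeLin_vert q; rw [h, C.inner_planeLin_vert] at this; linarith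
  ext i; fin_cases i
  · exact h0
  · exact h1

/-- The plane map is injective. [folklore] -/
theorem planeMap_injective : Injective C.planeMap := by
  intro q q' h
  rw [planeMap_eq, planeMap_eq, add_right_inj] at h
  exact C.planeLin_injective h

/-- The plane map is `C^∞`. [folklore] -/
theorem contDiff_planeMap : ContDiff ℝ ∞ C.planeMap := by
  have : C.planeMap = fun q ↦ C.p + C.planeLin q := funext C.planeMap_eq
  rw [this]
  exact contDiff_const.add C.planeLin.contDiff

/-- The plane map has derivative its linear part. [folklore] -/
theorem hasFDerivAt_planeMap (q : 𝔼 2) : HasFDerivAt C.planeMap C.planeLin q := by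
  have : C.planeMap = fun q ↦ C.p + C.planeLin q := funext C.planeMap_eq
  rw [this]
  exact (C.planeLin.hasFDerivAt).const_add C.p

/-- `fderiv planeMap = planeLin`. [folklore] -/
@[simp] theorem fderiv_planeMap (q : 𝔼 2) : fderiv ℝ C.planeMap q = C.planeLin :=
  (C.hasFDerivAt_planeMap q).fderiv

/-- Two plane points are equal iff their coordinates are. [folklore] -/
theorem planeMap_eq_iff {q q' : 𝔼 2} : C.planeMap q = C.planeMap q' ↔ q = q' :=
  C.planeMap_injective.eq_iff

/-- A plane point equals `p + s e` iff it is `(s, 0)`. [folklore] -/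
theorem planeMap_eq_add_smul_iff {q : 𝔼 2} {s : ℝ} :
    C.planeMap q = C.p + s • C.e ↔ q 0 = s ∧ q 1 = 0 := by
  have : C.p + s • C.e = C.planeMap (pt2 s 0) := by rw [planeMap_pt2, zero_smul, sub_zero]
  rw [this, planeMap_eq_iff]
  constructor
  · rintro rfl; exact ⟨rfl, rfl⟩
  · rintro ⟨h0, h1⟩; ext i; fin_cases i
    · exact h0
    · exact h1

/-! #### The plane lifted to the sphere -/

/-- **The plane in `𝕊³`**: `ψ⁻¹ ∘ planeMap`. [folklore] -/
def toSphere (q : 𝔼 2) : 𝕊 3 := psi.symm (C.planeMap q)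

/-- Pointwise formula. [folklore] -/
theorem toSphere_apply (q : 𝔼 2) : C.toSphere q = psi.symm (C.planeMap q) := rfl

/-- `ψ ∘ toSphere = planeMap`. [folklore] -/
@[simp] theorem psi_toSphere (q : 𝔼 2) : psi (C.toSphere q) = C.planeMap q :=
  psi_apply_psi_symm _

/-- `toSphere` misses the south pole. [folklore] -/
theorem toSphere_ne_southPole (q : 𝔼 2) : C.toSphere q ≠ southPole := psi_symm_ne_southPole _

/-- `toSphere` is injective. [folklore] -/
theorem toSphere_injective : Injective C.toSphere := by
  intro q q' h
  have := congrArg psi h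
  rw [psi_toSphere, psi_toSphere] at this
  exact C.planeMap_injective this

/-- `toSphere` read in `ℝ⁴` is `coePsiSymm ∘ planeMap`. [folklore] -/
theorem coe_toSphere (q : 𝔼 2) : ((C.toSphere q : 𝕊 3) : 𝔼 4) = coePsiSymm (C.planeMap q) := rfl

/-- `toSphere` read in `ℝ⁴` is `C^∞`. [folklore] -/
theorem contDiff_coe_toSphere : ContDiff ℝ ∞ fun q ↦ ((C.toSphere q : 𝕊 3) : 𝔼 4) :=
  contDiff_coePsiSymm.comp C.contDiff_planeMap

/-- `toSphere` is `C^∞` into `𝕊³`. [folklore] -/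
theorem contMDiff_toSphere : ContMDiff 𝓘(ℝ, 𝔼 2) (𝓡 3) ∞ C.toSphere :=
  contMDiff_psi_symm.comp C.contDiff_planeMap.contMDiff

/-- The derivative of `toSphere` read in `ℝ⁴` is `Dψ⁻¹ ∘ planeLin`, injective. [folklore] -/
theorem fderiv_coe_toSphere (q : 𝔼 2) :
    fderiv ℝ (fun q ↦ ((C.toSphere q : 𝕊 3) : 𝔼 4)) q =
      (fderiv ℝ coePsiSymm (C.planeMap q)).comp C.planeLin := by
  have h := fderiv_comp q (contDiff_coePsiSymm.differentiable (by simp) (C.planeMap q))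
    (C.contDiff_planeMap.differentiable (by simp) q)
  rw [C.fderiv_planeMap] at h
  exact h

/-- **The plane in `𝕊³` is immersed**: the derivative of `toSphere` (read in `ℝ⁴`) is injective.
[folklore] -/
theorem injective_fderiv_coe_toSphere (q : 𝔼 2) :
    Injective (fderiv ℝ (fun q ↦ ((C.toSphere q : 𝕊 3) : 𝔼 4)) q) := by
  rw [fderiv_coe_toSphere]
  exact (injective_fderiv_coePsiSymm _).comp C.planeLin_injective

/-- The derivative of `toSphere` (read in `ℝ⁴`) in the direction `v` is `Dψ⁻¹ (planeLin v)`.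
[folklore] -/
theorem fderiv_coe_toSphere_apply (q v : 𝔼 2) :
    fderiv ℝ (fun q ↦ ((C.toSphere q : 𝕊 3) : 𝔼 4)) q v =
      fderiv ℝ coePsiSymm (C.planeMap q) (C.planeLin v) := by
  rw [fderiv_coe_toSphere]; rfl

/-- Chain rule for a planar curve lifted to the sphere: the velocity of `toSphere ∘ c` is
`Dψ⁻¹ (planeLin (c' θ))`. [folklore] -/
theorem deriv_coe_toSphere_comp {c : ℝ → 𝔼 2} {θ : ℝ} (hc : DifferentiableAt ℝ c θ) :
    deriv (fun t ↦ ((C.toSphere (c t) : 𝕊 3) : 𝔼 4)) θ =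
      fderiv ℝ coePsiSymm (C.planeMap (c θ)) (C.planeLin (deriv c θ)) := by
  have h1 : deriv (fun t ↦ ((C.toSphere (c t) : 𝕊 3) : 𝔼 4)) θ =
      fderiv ℝ (fun q ↦ ((C.toSphere q : 𝕊 3) : 𝔼 4)) (c θ) (deriv c θ) :=
    fderiv_comp_deriv θ (C.contDiff_coe_toSphere.differentiable (by simp) _) hc
  rw [h1, fderiv_coe_toSphere_apply]

/-- The velocity of a lifted planar curve vanishes only where the planar velocity does.
[folklore] -/
theorem deriv_coe_toSphere_comp_ne_zero {c : ℝ → 𝔼 2} {θ : ℝ} (hc : DifferentiableAt ℝ c θ)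
    (h : deriv c θ ≠ 0) : deriv (fun t ↦ ((C.toSphere (c t) : 𝕊 3) : 𝔼 4)) θ ≠ 0 := by
  rw [C.deriv_coe_toSphere_comp hc]
  intro h0
  have h1 := injective_fderiv_coePsiSymm (C.planeMap (c θ)) (a₁ := C.planeLin (deriv c θ))
    (a₂ := 0) (by rw [h0, map_zero])
  exact h (C.planeLin_injective (by rw [h1, map_zero]))

/-! #### The knot in the chart -/

/-- The chart point `ψ (K x)` of a point of the knot. [folklore] -/
def chartPt (x : 𝕊 1) : 𝔼 3 := psi (C.K x)

/-- Pointwise formula. [folklore] -/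
theorem chartPt_apply (x : 𝕊 1) : C.chartPt x = psi (C.K x) := rfl

/-- `ψ⁻¹ (chartPt x) = K x`. [folklore] -/
@[simp] theorem psi_symm_chartPt (x : 𝕊 1) : psi.symm (C.chartPt x) = C.K x :=
  psi_symm_apply_psi (C.ne_southPole x)

/-- The chart curve of the knot is `chartPt ∘ circlePoint`. [folklore] -/
theorem chartCurve_eq_chartPt (θ : ℝ) : C.K.chartCurve θ = C.chartPt (circlePoint θ) := rfl

/-- `chartPt` is injective. [folklore] -/
theorem chartPt_injective : Injective C.chartPt := by
  intro x y h
  have := congrArg psi.symm h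
  rw [psi_symm_chartPt, psi_symm_chartPt] at this
  exact C.K.injective this

/-- Over the window the chart curve is the segment: `chartCurve θ = planeMap (σ θ, 0)`.
[folklore] -/
theorem chartCurve_eq_planeMap {θ : ℝ} (hθ : θ ∈ Icc C.α C.β) :
    C.K.chartCurve θ = C.planeMap (pt2 (C.σ θ) 0) := by
  rw [planeMap_pt2, zero_smul, sub_zero]
  exact C.seg θ hθ

/-- Over the window the knot is the lifted segment: `K (cos θ, sin θ) = toSphere (σ θ, 0)`.
[folklore] -/
theorem apply_circlePoint_eq_toSphere {θ : ℝ} (hθ : θ ∈ Icc C.α C.β) :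
    C.K (circlePoint θ) = C.toSphere (pt2 (C.σ θ) 0) := by
  rw [toSphere_apply, ← C.chartCurve_eq_planeMap hθ, Knot.psi_symm_chartCurve C.ne_southPole]

/-! #### The parametrisation of the segment -/

/-- `σ` is continuous. [folklore] -/
theorem continuous_σ : Continuous C.σ := C.contDiff_σ.continuous

/-- `σ` is differentiable. [folklore] -/
theorem differentiable_σ : Differentiable ℝ C.σ := C.contDiff_σ.differentiable (by simp)

/-- `σ` is strictly increasing on the window. [folklore] -/
theorem strictMonoOn_σ : StrictMonoOn C.σ (Icc C.α C.β) :=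
  strictMonoOn_of_deriv_pos (convex_Icc _ _) C.continuous_σ.continuousOn fun θ hθ ↦
    C.deriv_σ_pos θ (interior_subset hθ)

/-- `σ` maps the window into `[-ℓ, ℓ]`. [folklore] -/
theorem σ_mem {θ : ℝ} (hθ : θ ∈ Icc C.α C.β) : C.σ θ ∈ Icc (-C.ℓ) C.ℓ := by
  constructor
  · rw [← C.σ_α]
    exact C.strictMonoOn_σ.monotoneOn (left_mem_Icc.2 C.α_lt_β.le) hθ hθ.1
  · rw [← C.σ_β]
    exact C.strictMonoOn_σ.monotoneOn hθ (right_mem_Icc.2 C.α_lt_β.le) hθ.2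

/-- `|σ θ| ≤ ℓ` on the window. [folklore] -/
theorem abs_σ_le {θ : ℝ} (hθ : θ ∈ Icc C.α C.β) : |C.σ θ| ≤ C.ℓ :=
  abs_le.2 ⟨(C.σ_mem hθ).1, (C.σ_mem hθ).2⟩

/-- Every `s ∈ [-ℓ, ℓ]` is `σ θ` for a unique... for some `θ` in the window (intermediate value
theorem). [folklore] -/
theorem exists_σ_eq {s : ℝ} (hs : s ∈ Icc (-C.ℓ) C.ℓ) : ∃ θ ∈ Icc C.α C.β, C.σ θ = s := by
  have h := intermediate_value_Icc C.α_lt_β.le C.continuous_σ.continuousOn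
  rw [C.σ_α, C.σ_β] at h
  exact h hs

/-- **The parameter of a segment point**: `θOf s` is the `θ ∈ [α, β]` with `σ θ = s`
(for `|s| ≤ ℓ`; junk otherwise). [folklore] -/
def θOf (s : ℝ) : ℝ :=
  if hs : s ∈ Icc (-C.ℓ) C.ℓ then (C.exists_σ_eq hs).choose else C.α

/-- `θOf s` lies in the window. [folklore] -/
theorem θOf_mem {s : ℝ} (hs : s ∈ Icc (-C.ℓ) C.ℓ) : C.θOf s ∈ Icc C.α C.β := by
  rw [θOf, dif_pos hs]; exact (C.exists_σ_eq hs).choose_spec.1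

/-- `σ (θOf s) = s`. [folklore] -/
@[simp] theorem σ_θOf {s : ℝ} (hs : s ∈ Icc (-C.ℓ) C.ℓ) : C.σ (C.θOf s) = s := by
  rw [θOf, dif_pos hs]; exact (C.exists_σ_eq hs).choose_spec.2

/-- `θOf (σ θ) = θ` on the window. [folklore] -/
theorem θOf_σ {θ : ℝ} (hθ : θ ∈ Icc C.α C.β) : C.θOf (C.σ θ) = θ :=
  C.strictMonoOn_σ.injOn (C.θOf_mem (C.σ_mem hθ)) hθ (C.σ_θOf (C.σ_mem hθ))

/-- `θOf` is strictly increasing on `[-ℓ, ℓ]`. [folklore] -/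
theorem θOf_lt_θOf {s s' : ℝ} (hs : s ∈ Icc (-C.ℓ) C.ℓ) (hs' : s' ∈ Icc (-C.ℓ) C.ℓ) (h : s < s') :
    C.θOf s < C.θOf s' := by
  by_contra hle
  push Not at hle
  have := C.strictMonoOn_σ.monotoneOn (C.θOf_mem hs') (C.θOf_mem hs) hle
  rw [C.σ_θOf hs, C.σ_θOf hs'] at this
  linarith

/-- The segment point with tangent coordinate `s` lies on the knot. [folklore] -/
theorem toSphere_pt2_mem_range {s : ℝ} (hs : s ∈ Icc (-C.ℓ) C.ℓ) :
    C.toSphere (pt2 s 0) ∈ range C.K := by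
  refine ⟨circlePoint (C.θOf s), ?_⟩
  rw [C.apply_circlePoint_eq_toSphere (C.θOf_mem hs), C.σ_θOf hs]

/-- **Segment points of the knot come from the window**: if `ψ (K x) = p + s e` with `|s| ≤ ℓ`
then `x = (cos θ, sin θ)` for some `θ ∈ [α, β]` (with `σ θ = s`). [folklore] -/
theorem exists_eq_circlePoint_of_chartPt_eq {x : 𝕊 1} {s : ℝ} (hs : s ∈ Icc (-C.ℓ) C.ℓ)
    (hx : C.chartPt x = C.p + s • C.e) : ∃ θ ∈ Icc C.α C.β, x = circlePoint θ ∧ C.σ θ = s := by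
  refine ⟨C.θOf s, C.θOf_mem hs, ?_, C.σ_θOf hs⟩
  apply C.K.injective
  rw [C.apply_circlePoint_eq_toSphere (C.θOf_mem hs), C.σ_θOf hs, toSphere_apply, planeMap_pt2,
    zero_smul, sub_zero, ← hx, chartPt_apply, psi_symm_apply_psi (C.ne_southPole x)]

/-- **The clean box, planar form**: a knot point whose chart point has tangent coordinate of
absolute value `< ℓ` and height `< p₂ + ν` is a segment point `K (cos θ, sin θ)`, `θ ∈ [α, β]`.
[folklore] -/
theorem exists_eq_circlePoint_of_box {x : 𝕊 1} (h1 : |⟪C.chartPt x - C.p, C.e⟫| < C.ℓ)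
    (h2 : C.chartPt x 2 < C.p 2 + C.ν) : ∃ θ ∈ Icc C.α C.β, x = circlePoint θ := by
  obtain ⟨s, hs, hxs⟩ := C.box x h1 h2
  obtain ⟨θ, hθ, hx, -⟩ := C.exists_eq_circlePoint_of_chartPt_eq hs hxs
  exact ⟨θ, hθ, hx⟩

/-- **A knot point in the plane region `{|s| < ℓ, d > -ν}` is a segment point.** If
`K x = toSphere (s, d)` with `|s| < ℓ` and `-ν < d`, then `d = 0`, and `x = (cos θ, sin θ)` with
`θ ∈ [α, β]`, `σ θ = s`. [folklore] -/
theorem eq_of_apply_eq_toSphere {x : 𝕊 1} {q : 𝔼 2} (hq0 : |q 0| < C.ℓ) (hq1 : -C.ν < q 1)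
    (hx : C.K x = C.toSphere q) : q 1 = 0 ∧ ∃ θ ∈ Icc C.α C.β, x = circlePoint θ ∧ C.σ θ = q 0 := by
  have hc : C.chartPt x = C.planeMap q := by rw [chartPt_apply, hx, toSphere_apply, psi_apply_psi_symm]
  have h1 : |⟪C.chartPt x - C.p, C.e⟫| < C.ℓ := by rwa [hc, inner_planeMap_sub_e]
  have h2 : C.chartPt x 2 < C.p 2 + C.ν := by rw [hc, planeMap_apply_two]; linarith
  obtain ⟨s, hs, hxs⟩ := C.box x h1 h2
  change C.chartPt x = C.p + s • C.e at hxs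
  have hxs' := hxs
  rw [hc, planeMap_eq_add_smul_iff] at hxs'
  obtain ⟨rfl, hq⟩ := hxs'
  obtain ⟨θ, hθ, hxθ, hσ⟩ := C.exists_eq_circlePoint_of_chartPt_eq hs hxs
  exact ⟨hq, θ, hθ, hxθ, hσ⟩

/-- Knot points have depth `≤ 0` in the plane: if `K x = toSphere (s, d)` then `d ≤ 0`... more
precisely the height bound `p₂ ≤ ψ(K x)₂` reads `d ≤ 0`. [folklore] -/
theorem depth_nonpos_of_apply_eq_toSphere {x : 𝕊 1} {q : 𝔼 2} (hx : C.K x = C.toSphere q) :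
    q 1 ≤ 0 := by
  have h := C.height x
  rw [hx, psi_toSphere, planeMap_apply_two] at h
  linarith

/-- The chart image of the knot is bounded. [folklore] -/
theorem exists_norm_chartPt_le : ∃ ρ : ℝ, 0 < ρ ∧ ∀ x, ‖C.chartPt x‖ ≤ ρ := by
  have hc : Continuous C.chartPt :=
    psi.continuousOn.comp_continuous C.K.continuous fun x ↦ mem_psi_source (C.ne_southPole x)
  obtain ⟨ρ, hρ⟩ := (isCompact_range hc).isBounded.subset_closedBall 0
  refine ⟨max ρ 1, by positivity, fun x ↦ ?_⟩
  have := hρ ⟨x, rfl⟩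
  rw [mem_closedBall, dist_zero_right] at this
  exact this.trans (le_max_left _ _)

/-! #### Window parameters modulo `2π` -/

/-- Two parameters of the window with the same circle point are equal (the window is shorter
than `2π`). [folklore] -/
theorem eq_of_circlePoint_eq {θ θ' : ℝ} (hθ : θ ∈ Icc C.α C.β) (hθ' : θ' ∈ Icc C.α C.β)
    (h : circlePoint θ = circlePoint θ') : θ = θ' := by
  obtain ⟨k, hk⟩ := exists_eq_add_of_circlePoint_eq h
  have hβ := C.β_lt
  have h1 : (k : ℝ) * (2 * Real.pi) < 2 * Real.pi := by nlinarith [hθ.2, hθ'.1, Real.pi_pos]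
  have h2 : -(2 * Real.pi) < (k : ℝ) * (2 * Real.pi) := by nlinarith [hθ.1, hθ'.2, Real.pi_pos]
  have hk1 : (k : ℝ) < 1 := by
    by_contra hle; push Not at hle; nlinarith [Real.pi_pos]
  have hk2 : (-1 : ℝ) < k := by
    by_contra hle; push Not at hle; nlinarith [Real.pi_pos]
  have : k = 0 := by
    have a : k < 1 := by exact_mod_cast hk1
    have b : -1 < k := by exact_mod_cast hk2
    omega
  rw [this] at hk; simpa using hk

/-- The tangent coordinate is determined by the circle point on the window. [folklore] -/
theorem σ_eq_of_circlePoint_eq {θ θ' : ℝ} (hθ : θ ∈ Icc C.α C.β) (hθ' : θ' ∈ Icc C.α C.β)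
    (h : circlePoint θ = circlePoint θ') : C.σ θ = C.σ θ' := by
  rw [C.eq_of_circlePoint_eq hθ hθ' h]

end FlatArcConfig

end BandSumUnit

end Literature.Topology.FourManifolds
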